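import Summits.KontsevichZagierPeriods.KontsevichZagierPeriods.Theorems.HermiteRigidityGenusTwoCycleTransferPushforwardDimOne
import Literature.NumberTheory.Transcendental.KZBetaChains
import Literature.NumberTheory.Transcendental.KZLogCalculusProofs
import Literature.NumberTheory.Transcendental.KZSemialgebraicComplex
import Literature.NumberTheory.Transcendental.KZIntervalPeriodProofs
import Literature.NumberTheory.Transcendental.SemialgebraicLineDeriv
import Literature.NumberTheory.Transcendental.SemialgebraicMapsProofs

/-!
# Crux `TriplicationAccessible` (stmt-KontsevichZagierPeriods-0312), line `aoki-shioda-cm-lift`: stub S1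

`stub_aokiShiodaSixteen` (registered signature): `[(0,1), x^{-8/9}(1-x)^{-1/3}] ~
[(0,1), 3^{-1/3}(u^{-7/9}(1-u)^{-4/9} + u^{-7/9}(1-u)^{-7/9})]` (`B(1/9,2/3) = 3^{-1/3}(B(2/9,5/9)+B(2/9,2/9))`)
by ONE change of variables `x = Ψ(u) = (1-c)²/(1+c+c²)`, `c = (1-u)^{1/3}` — the real branch of the
CM-by-`√-3` (Aoki–Shioda) correspondence of the Fermat curve `F₉` — with explicit inverse
`u = 1 - c(x)³`, `c(x) = (x+2-√(3x(4-x)))/(2(1-x))`, and the POINTWISE Jacobian identity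
`Ψ^{-8/9}(1-Ψ)^{-1/3}Ψ' = 3^{-1/3}(u^{-7/9}(1-u)^{-4/9} + u^{-7/9}(1-u)^{-7/9})`; the push-forward is built by
the landed engine `GenusTwoCycleTransfer.stub_pushforwardDimOne`, then `KZ.of_sub_of_mem_relations_of_eqOn`.
References: Aoki–Shioda (1983) Thm 2; Koblitz–Rohrlich (1978) Thm 3; Kontsevich–Zagier (2001) §1.2 (2).
-/

noncomputable section

open Set MeasureTheory Real
open Literature.NumberTheory.Transcendental Literature.ModelTheory.ExponentialFields

namespace Summit.KontsevichZagierPeriods.KontsevichZagierPeriods.Cruxes.TriplicationAccessible.AokiShiodaCmLift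

namespace AokiShiodaSixteen

/-- The cube-root coordinate `c(u) = (1-u)^{1/3}`. -/
def cr (u : ℝ) : ℝ := (1 - u) ^ ((1:ℝ)/3)

/-- The substitution `Ψ(u) = (1 - c)²/(1 + c + c²)`, `c = (1-u)^{1/3}`. -/
def psi (u : ℝ) : ℝ := (1 - cr u) ^ 2 / (1 + cr u + (cr u) ^ 2)

/-- Its derivative `Ψ'(u) = (1 - c²)/(c²(1 + c + c²)²)`. -/
def dpsi (u : ℝ) : ℝ := (1 - (cr u) ^ 2) / ((cr u) ^ 2 * (1 + cr u + (cr u) ^ 2) ^ 2)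

/-- The inverse cube-root coordinate `c(x) = (x + 2 - √(3x(4-x)))/(2(1-x))`. -/
def cinv (x : ℝ) : ℝ := (x + 2 - Real.sqrt (3 * x * (4 - x))) / (2 * (1 - x))

/-- The inverse substitution `u = 1 - c(x)³`. -/
def psiInv (x : ℝ) : ℝ := 1 - (cinv x) ^ 3

/-- `0 < c < 1` and `c³ = 1 - u` for `c = (1-u)^{1/3}`, `u ∈ (0,1)`. [folklore] -/
theorem cr_facts {u : ℝ} (hu0 : 0 < u) (hu1 : u < 1) : 0 < cr u ∧ cr u < 1 ∧ (cr u) ^ 3 = 1 - u := by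
  have h1u : 0 < 1 - u := by linarith
  have hc0 : 0 < cr u := Real.rpow_pos_of_pos h1u _
  have hc3 : (cr u) ^ 3 = 1 - u := by
    unfold cr
    rw [show (((1 - u) ^ ((1:ℝ)/3)) ^ 3 : ℝ) = ((1 - u) ^ ((1:ℝ)/3)) ^ (3:ℝ) by norm_cast,
      ← Real.rpow_mul h1u.le]; norm_num
  have hc1 : cr u < 1 := by
    calc cr u = (1 - u) ^ ((1:ℝ)/3) := rfl
      _ < (1:ℝ) ^ ((1:ℝ)/3) := Real.rpow_lt_rpow h1u.le (by linarith) (by norm_num)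
      _ = 1 := Real.one_rpow _
  exact ⟨hc0, hc1, hc3⟩

/-- `Ψ(u) ∈ (0,1)` for `u ∈ (0,1)`. [folklore] -/
theorem psi_mem {u : ℝ} (hu0 : 0 < u) (hu1 : u < 1) : psi u ∈ Set.Ioo (0:ℝ) 1 := by
  obtain ⟨hc0, hc1, -⟩ := cr_facts hu0 hu1
  unfold psi
  set c := cr u
  have hq : 0 < 1 + c + c ^ 2 := by positivity
  have hd : 0 < 1 - c := by linarith
  refine ⟨div_pos (pow_pos hd 2) hq, ?_⟩
  rw [div_lt_one hq]
  nlinarith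

/-- `Ψ'(u) > 0` for `u ∈ (0,1)`. [folklore] -/
theorem dpsi_pos {u : ℝ} (hu0 : 0 < u) (hu1 : u < 1) : 0 < dpsi u := by
  obtain ⟨hc0, hc1, -⟩ := cr_facts hu0 hu1
  unfold dpsi
  set c := cr u
  have h1 : 0 < 1 - c ^ 2 := by nlinarith
  positivity

/-- `Ψ` has derivative `Ψ'` on `(0,1)` (chain rule through the cube root). [folklore] -/
theorem hasDerivAt_psi' {u : ℝ} (hu0 : 0 < u) (hu1 : u < 1) : HasDerivAt psi (dpsi u) u := by
  obtain ⟨hc0, hc1, hc3⟩ := cr_facts hu0 hu1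
  have h1u : 0 < 1 - u := by linarith
  have hg : HasDerivAt cr ((-1) * ((1:ℝ)/3) * (1 - u) ^ ((1:ℝ)/3 - 1)) u :=
    ((hasDerivAt_id u).const_sub 1).rpow_const (Or.inl h1u.ne')
  set c := cr u with hc
  have hq : 0 < 1 + c + c ^ 2 := by positivity
  have hΦ : HasDerivAt (fun x : ℝ => (1 - x) ^ 2 / (1 + x + x ^ 2))
      ((↑(2:ℕ) * (1 - c) ^ (2 - 1) * (-1) * (1 + c + c ^ 2) - (1 - c) ^ 2 * (1 + 2 * c)) /
        (1 + c + c ^ 2) ^ 2) c := by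
    have h1 : HasDerivAt (fun x : ℝ => (1 - x) ^ 2) (↑(2:ℕ) * (1 - c) ^ (2 - 1) * (-1)) c :=
      ((hasDerivAt_id' c).const_sub 1).pow 2
    have h2 : HasDerivAt (fun x : ℝ => 1 + x + x ^ 2) (1 + 2 * c) c := by
      have ha : HasDerivAt (fun x : ℝ => 1 + x) 1 c := (hasDerivAt_id' c).const_add 1
      have hb : HasDerivAt (fun x : ℝ => x ^ 2) (↑(2:ℕ) * c ^ (2 - 1) * 1) c :=
        (hasDerivAt_id' c).pow 2
      refine (ha.add hb).congr_deriv ?_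
      push_cast; ring
    exact h1.div h2 hq.ne'
  have hcomp := hΦ.comp u hg
  have hpow : (1 - u) ^ ((1:ℝ)/3 - 1) = (c ^ 2)⁻¹ := by
    rw [show ((1:ℝ)/3 - 1) = ((1:ℝ)/3) * (-2) by norm_num, Real.rpow_mul h1u.le]
    change (cr u) ^ (-2:ℝ) = _
    rw [← hc, Real.rpow_neg hc0.le, show ((2:ℝ)) = ((2:ℕ):ℝ) by norm_num, Real.rpow_natCast]
  have hcne : c ≠ 0 := hc0.ne'
  have hqne : (1 + c + c ^ 2) ≠ 0 := hq.ne'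
  refine hcomp.congr_deriv ?_
  rw [hpow]; unfold dpsi; rw [← hc]; field_simp; ring

/-- `(c³)^{-4/9} + (c³)^{-7/9} = c^{-7/3}(c+1)`. -/
theorem kernel_sum_factor' {c : ℝ} (hc0 : 0 < c) :
    (c ^ 3) ^ (-(4:ℝ)/9) + (c ^ 3) ^ (-(7:ℝ)/9) = c ^ (-(7:ℝ)/3) * (c + 1) := by
  have e2 : (c ^ 3) ^ (-(4:ℝ)/9) = c ^ (-(4:ℝ)/3) := by
    rw [show (c ^ 3 : ℝ) = c ^ (3:ℝ) by norm_cast, ← Real.rpow_mul hc0.le]; norm_num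
  have e3 : (c ^ 3) ^ (-(7:ℝ)/9) = c ^ (-(7:ℝ)/3) := by
    rw [show (c ^ 3 : ℝ) = c ^ (3:ℝ) by norm_cast, ← Real.rpow_mul hc0.le]; norm_num
  rw [e2, e3, mul_add, mul_one, show (-(4:ℝ)/3) = -(7:ℝ)/3 + 1 by norm_num, Real.rpow_add hc0,
    Real.rpow_one]

/-- The pointwise Jacobian identity in the cube-root coordinate. -/
theorem jacobian_c {c : ℝ} (hc0 : 0 < c) (hc1 : c < 1) :
    ((1 - c) ^ 2 / (1 + c + c ^ 2)) ^ (-(8:ℝ)/9) * (1 - (1 - c) ^ 2 / (1 + c + c ^ 2)) ^ (-(1:ℝ)/3) *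
        ((1 - c ^ 2) / (c ^ 2 * (1 + c + c ^ 2) ^ 2)) =
      (3:ℝ) ^ (-(1:ℝ)/3) * ((1 - c) * (1 + c + c ^ 2)) ^ (-(7:ℝ)/9) *
        ((c ^ 3) ^ (-(4:ℝ)/9) + (c ^ 3) ^ (-(7:ℝ)/9)) := by
  have hq : 0 < 1 + c + c ^ 2 := by positivity
  have hd : 0 < 1 - c := by linarith
  have hp : 0 < 1 + c := by linarith
  have h1 : 1 - (1 - c) ^ 2 / (1 + c + c ^ 2) = 3 * c / (1 + c + c ^ 2) := by
    field_simp; ring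
  rw [h1, kernel_sum_factor' hc0, show (1:ℝ) - c ^ 2 = (1 - c) * (1 + c) by ring]
  have posL : 0 < ((1 - c) ^ 2 / (1 + c + c ^ 2)) ^ (-(8:ℝ)/9) * (3 * c / (1 + c + c ^ 2)) ^ (-(1:ℝ)/3) *
      ((1 - c) * (1 + c) / (c ^ 2 * (1 + c + c ^ 2) ^ 2)) := by positivity
  have posR : 0 < (3:ℝ) ^ (-(1:ℝ)/3) * ((1 - c) * (1 + c + c ^ 2)) ^ (-(7:ℝ)/9) *
      (c ^ (-(7:ℝ)/3) * (c + 1)) := by positivity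
  refine Real.log_injOn_pos (Set.mem_Ioi.2 posL) (Set.mem_Ioi.2 posR) ?_
  have hdne : (1 - c) ≠ 0 := hd.ne'
  have hqne : (1 + c + c ^ 2) ≠ 0 := hq.ne'
  have hcne : c ≠ 0 := hc0.ne'
  have hpne : (1 + c) ≠ 0 := hp.ne'
  have hpne' : (c + 1) ≠ 0 := by rw [add_comm]; exact hpne
  have h3 : (0:ℝ) < 3 := by norm_num
  have hA : 0 < (1 - c) ^ 2 / (1 + c + c ^ 2) := div_pos (pow_pos hd 2) hq
  have hB : 0 < 3 * c / (1 + c + c ^ 2) := div_pos (mul_pos h3 hc0) hq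
  have hC : 0 < (1 - c) * (1 + c) / (c ^ 2 * (1 + c + c ^ 2) ^ 2) :=
    div_pos (mul_pos hd hp) (mul_pos (pow_pos hc0 2) (pow_pos hq 2))
  have hAa : ((1 - c) ^ 2 / (1 + c + c ^ 2)) ^ (-(8:ℝ)/9) ≠ 0 := (Real.rpow_pos_of_pos hA _).ne'
  have hBb : (3 * c / (1 + c + c ^ 2)) ^ (-(1:ℝ)/3) ≠ 0 := (Real.rpow_pos_of_pos hB _).ne'
  rw [Real.log_mul (mul_ne_zero hAa hBb) hC.ne', Real.log_mul hAa hBb, Real.log_rpow hA,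
    Real.log_rpow hB, Real.log_div (pow_pos hd 2).ne' hqne, Real.log_pow,
    Real.log_div (mul_pos h3 hc0).ne' hqne, Real.log_mul h3.ne' hcne,
    Real.log_div (mul_pos hd hp).ne' (mul_pos (pow_pos hc0 2) (pow_pos hq 2)).ne',
    Real.log_mul hdne hpne, Real.log_mul (pow_pos hc0 2).ne' (pow_pos hq 2).ne', Real.log_pow,
    Real.log_pow]
  have hT : (3:ℝ) ^ (-(1:ℝ)/3) ≠ 0 := (Real.rpow_pos_of_pos h3 _).ne'
  have hS : ((1 - c) * (1 + c + c ^ 2)) ^ (-(7:ℝ)/9) ≠ 0 := (Real.rpow_pos_of_pos (mul_pos hd hq) _).ne'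
  have hE : c ^ (-(7:ℝ)/3) ≠ 0 := (Real.rpow_pos_of_pos hc0 _).ne'
  rw [Real.log_mul (mul_ne_zero hT hS) (mul_ne_zero hE hpne'), Real.log_mul hT hS,
    Real.log_mul hE hpne', Real.log_rpow h3, Real.log_rpow (mul_pos hd hq), Real.log_mul hdne hqne,
    Real.log_rpow hc0, show c + 1 = 1 + c from add_comm c 1]
  push_cast; ring

/-- **The Jacobian identity in the coordinate `u`**: `Ψ^{-8/9}(1-Ψ)^{-1/3}·Ψ'` is the u-side kernel. -/
theorem jacobian_u {u : ℝ} (hu0 : 0 < u) (hu1 : u < 1) :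
    (psi u) ^ (-(8:ℝ)/9) * (1 - psi u) ^ (-(1:ℝ)/3) * dpsi u =
      (3:ℝ) ^ (-(1:ℝ)/3) * (u ^ (-(7:ℝ)/9) * (1 - u) ^ (-(4:ℝ)/9) + u ^ (-(7:ℝ)/9) * (1 - u) ^ (-(7:ℝ)/9)) := by
  obtain ⟨hc0, hc1, hc3⟩ := cr_facts hu0 hu1
  have hu : u = (1 - cr u) * (1 + cr u + (cr u) ^ 2) := by linear_combination hc3
  unfold psi dpsi
  rw [jacobian_c hc0 hc1, ← hu, hc3]
  ring

/-- `√(3Ψ(4-Ψ)) = 3(1-c)(1+c)/(1+c+c²)` in the cube-root coordinate. [folklore] -/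
theorem sqrt_at_psi {c : ℝ} (hc0 : 0 < c) (hc1 : c < 1) :
    Real.sqrt (3 * ((1 - c) ^ 2 / (1 + c + c ^ 2)) * (4 - (1 - c) ^ 2 / (1 + c + c ^ 2))) =
      3 * (1 - c) * (1 + c) / (1 + c + c ^ 2) := by
  have hq : 0 < 1 + c + c ^ 2 := by positivity
  have hy : 0 ≤ 3 * (1 - c) * (1 + c) / (1 + c + c ^ 2) := by
    apply div_nonneg _ hq.le; nlinarith
  rw [show 3 * ((1 - c) ^ 2 / (1 + c + c ^ 2)) * (4 - (1 - c) ^ 2 / (1 + c + c ^ 2)) =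
      (3 * (1 - c) * (1 + c) / (1 + c + c ^ 2)) ^ 2 by field_simp; ring]
  exact Real.sqrt_sq hy

/-- `c(Ψ(u)) = (1-u)^{1/3}`: the inverse recovers the cube-root coordinate. -/
theorem cinv_psi {u : ℝ} (hu0 : 0 < u) (hu1 : u < 1) : cinv (psi u) = cr u := by
  obtain ⟨hc0, hc1, -⟩ := cr_facts hu0 hu1
  unfold cinv psi
  set c := cr u
  have hq : 0 < 1 + c + c ^ 2 := by positivity
  rw [sqrt_at_psi hc0 hc1]
  have hne : (2:ℝ) * (1 - (1 - c) ^ 2 / (1 + c + c ^ 2)) ≠ 0 := by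
    have : 1 - (1 - c) ^ 2 / (1 + c + c ^ 2) = 3 * c / (1 + c + c ^ 2) := by field_simp; ring
    rw [this]; positivity
  rw [div_eq_iff hne]
  field_simp
  ring

/-- The inverse is a left inverse: `1 - c(Ψ(u))³ = u`. [folklore] -/
theorem psiInv_psi {u : ℝ} (hu0 : 0 < u) (hu1 : u < 1) : psiInv (psi u) = u := by
  obtain ⟨-, -, hc3⟩ := cr_facts hu0 hu1
  unfold psiInv; rw [cinv_psi hu0 hu1, hc3]; ring

/-- `c(x) ∈ (0,1)` for `x ∈ (0,1)`. [folklore] -/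
theorem cinv_mem {x : ℝ} (hx0 : 0 < x) (hx1 : x < 1) : 0 < cinv x ∧ cinv x < 1 := by
  unfold cinv
  have hd : 0 < 2 * (1 - x) := by linarith
  have hrad : 0 ≤ 3 * x * (4 - x) := by nlinarith
  have hs_lt : Real.sqrt (3 * x * (4 - x)) < x + 2 := by
    rw [Real.sqrt_lt' (by linarith)]
    nlinarith
  have hs_gt : 3 * x < Real.sqrt (3 * x * (4 - x)) := by
    rw [Real.lt_sqrt (by linarith)]
    nlinarith
  constructor
  · apply div_pos _ hd; linarith
  · rw [div_lt_one hd]; linarith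

/-- The inverse maps `(0,1)` into `(0,1)`. [folklore] -/
theorem psiInv_mem {x : ℝ} (hx0 : 0 < x) (hx1 : x < 1) : psiInv x ∈ Set.Ioo (0:ℝ) 1 := by
  obtain ⟨h0, h1⟩ := cinv_mem hx0 hx1
  unfold psiInv
  have h3 : (cinv x) ^ 3 < 1 := by
    calc (cinv x) ^ 3 < 1 ^ 3 := by gcongr
      _ = 1 := one_pow 3
  exact ⟨by linarith, by nlinarith [pow_pos h0 3]⟩

/-- `(1 - (1 - c(x)³))^{1/3} = c(x)`. [folklore] -/
theorem cr_psiInv {x : ℝ} (hx0 : 0 < x) (hx1 : x < 1) : cr (psiInv x) = cinv x := by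
  obtain ⟨h0, -⟩ := cinv_mem hx0 hx1
  unfold cr psiInv
  rw [sub_sub_cancel, show ((cinv x) ^ 3 : ℝ) = (cinv x) ^ (3:ℝ) by norm_cast,
    ← Real.rpow_mul h0.le]
  norm_num

/-- `Ψ(1 - c(x)³) = x`: the inverse is a right inverse on `(0,1)`. -/
theorem psi_psiInv {x : ℝ} (hx0 : 0 < x) (hx1 : x < 1) : psi (psiInv x) = x := by
  obtain ⟨h0, h1⟩ := cinv_mem hx0 hx1
  unfold psi
  rw [cr_psiInv hx0 hx1]
  have h1x : 0 < 1 - x := by linarith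
  have hrad : 0 ≤ 3 * x * (4 - x) := by nlinarith
  set s := Real.sqrt (3 * x * (4 - x)) with hs
  have hs2 : s ^ 2 = 3 * x * (4 - x) := Real.sq_sqrt hrad
  have hcx : 2 * (1 - x) * cinv x = x + 2 - s := by
    unfold cinv
    rw [← hs]
    field_simp
  have key : 4 * (1 - x) * ((1 - x) * (cinv x) ^ 2 - (x + 2) * cinv x + (1 - x)) = 0 := by
    have h' : (x + 2 - 2 * (1 - x) * cinv x) ^ 2 = 3 * x * (4 - x) := by
      rw [hcx, show x + 2 - (x + 2 - s) = s by ring]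
      exact hs2
    linear_combination h'
  have hquad : (1 - x) * (cinv x) ^ 2 - (x + 2) * cinv x + (1 - x) = 0 := by
    have h4 : (4:ℝ) * (1 - x) ≠ 0 := by positivity
    exact (mul_eq_zero.mp key).resolve_left h4
  have hq : 0 < 1 + cinv x + (cinv x) ^ 2 := by positivity
  rw [div_eq_iff hq.ne']
  linear_combination hquad

/-- The open unit interval as a subset of `ℝ¹`. -/
def σ₁ : Set (Fin 1 → ℝ) := {p | p 0 ∈ Set.Ioo (0:ℝ) 1}

/-- `(0,1) ⊆ ℝ¹` is `ℚ`-semialgebraic. [folklore] -/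
theorem isSemialgebraic_σ₁ : IsSemialgebraic ℚ σ₁ := KZ.BallPeeling.isSemialgebraic_posIoo

open MvPolynomial in
/-- A polynomial expression in the coordinate `p 0` is `ℚ`-semialgebraic on `σ₁`. -/
theorem sa_poly (P : MvPolynomial (Fin 1) ℚ) :
    IsSemialgebraicFunOn ℚ σ₁ (fun p => MvPolynomial.aeval p P) :=
  isSemialgebraicFunOn_aeval isSemialgebraic_σ₁ P

open MvPolynomial in
/-- The cube root `(1 - p₀)^{1/3}` is `ℚ`-semialgebraic on `(0,1)` (a Mellin monomial). [folklore] -/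
theorem sa_cr : IsSemialgebraicFunOn ℚ σ₁ (fun p => cr (p 0)) := by
  refine (KZ.isSemialgebraicFunOn_mellinIntegrand isSemialgebraic_σ₁ ![1 - X 0] ![(1/3 : ℚ)] 1
    (fun p hp k => ?_)).congr fun p _ => ?_
  · have hp' : p 0 < 1 := hp.2
    fin_cases k
    simp only [Fin.zero_eta, Fin.isValue, Matrix.cons_val_zero, map_sub, map_one, aeval_X, sub_pos]
    exact hp'
  · simp only [KZ.mellinIntegrand_apply, Fin.prod_univ_one, Matrix.cons_val_zero, map_sub, map_one,
      aeval_X, Rat.cast_one, one_mul, cr]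
    norm_num

/-- Positivity of the cube-root coordinate on `σ₁`. [folklore] -/
theorem cr_pos_of_mem {p : Fin 1 → ℝ} (hp : p ∈ σ₁) : 0 < cr (p 0) := (cr_facts hp.1 hp.2).1

open MvPolynomial in
/-- Constants are `ℚ`-semialgebraic. [folklore] -/
theorem sa_one : IsSemialgebraicFunOn ℚ σ₁ (fun _ => (1:ℝ)) :=
  (sa_poly 1).congr fun p _ => by simp

open MvPolynomial in
/-- `Ψ` is `ℚ`-semialgebraic on `(0,1)`. [folklore] -/
theorem sa_psi : IsSemialgebraicFunOn ℚ σ₁ (fun p => psi (p 0)) := by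
  have hq : IsSemialgebraicFunOn ℚ σ₁ (fun p => 1 + cr (p 0) + (cr (p 0)) ^ 2) :=
    (sa_one.fun_add sa_cr).fun_add (sa_cr.fun_pow 2)
  have hn : IsSemialgebraicFunOn ℚ σ₁ (fun p => (1 - cr (p 0)) ^ 2) := (sa_one.fun_sub sa_cr).fun_pow 2
  exact hn.div hq fun p hp => by have := cr_pos_of_mem hp; positivity

open MvPolynomial in
/-- `Ψ'` is `ℚ`-semialgebraic on `(0,1)`. [folklore] -/
theorem sa_dpsi : IsSemialgebraicFunOn ℚ σ₁ (fun p => dpsi (p 0)) := by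
  have hq : IsSemialgebraicFunOn ℚ σ₁ (fun p => 1 + cr (p 0) + (cr (p 0)) ^ 2) :=
    (sa_one.fun_add sa_cr).fun_add (sa_cr.fun_pow 2)
  have hn : IsSemialgebraicFunOn ℚ σ₁ (fun p => 1 - (cr (p 0)) ^ 2) := sa_one.fun_sub (sa_cr.fun_pow 2)
  have hd : IsSemialgebraicFunOn ℚ σ₁ (fun p => (cr (p 0)) ^ 2 * (1 + cr (p 0) + (cr (p 0)) ^ 2) ^ 2) :=
    (sa_cr.fun_pow 2).fun_mul (hq.fun_pow 2)
  exact hn.div hd fun p hp => by have := cr_pos_of_mem hp; positivity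

open MvPolynomial in
/-- `c(x)` is `ℚ`-semialgebraic on `(0,1)` (square root of a polynomial). [folklore] -/
theorem sa_cinv : IsSemialgebraicFunOn ℚ σ₁ (fun p => cinv (p 0)) := by
  have hrad : IsSemialgebraicFunOn ℚ σ₁ (fun p => 3 * p 0 * (4 - p 0)) :=
    (sa_poly (C 3 * X 0 * (C 4 - X 0))).congr fun p _ => by simp
  have hsq : IsSemialgebraicFunOn ℚ σ₁ (fun p => Real.sqrt (3 * p 0 * (4 - p 0))) :=
    IsSemialgebraicFunOn.sqrt_holds hrad
  have hnum : IsSemialgebraicFunOn ℚ σ₁ (fun p => p 0 + 2 - Real.sqrt (3 * p 0 * (4 - p 0))) :=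
    ((sa_poly (X 0 + C 2)).congr fun p _ => by simp).fun_sub hsq
  have hden : IsSemialgebraicFunOn ℚ σ₁ (fun p => 2 * (1 - p 0)) :=
    (sa_poly (C 2 * (1 - X 0))).congr fun p _ => by simp
  exact hnum.div hden fun p hp => by have : p 0 < 1 := hp.2; nlinarith

/-- The inverse substitution is `ℚ`-semialgebraic on `(0,1)`. [folklore] -/
theorem sa_psiInv : IsSemialgebraicFunOn ℚ σ₁ (fun p => psiInv (p 0)) :=
  sa_one.fun_sub (sa_cinv.fun_pow 3)

/-- The inverse map `G(q) = (1 - c(q 0)³)` of `ℝ¹`. -/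
def G (q : Fin 1 → ℝ) : Fin 1 → ℝ := fun _ => psiInv (q 0)

/-- The inverse map of `ℝ¹` is a `ℚ`-semialgebraic map on `σ₁`. [folklore] -/
theorem sa_G : IsSemialgebraicMapOn ℚ σ₁ G :=
  IsSemialgebraicMapOn.of_forall isSemialgebraic_σ₁ fun _ => sa_psiInv

/-- The image of `σ₁` under `Ψ` (as a map of `ℝ¹`) is `σ₁`. -/
theorem image_psi : (fun p : Fin 1 → ℝ => fun _ : Fin 1 => psi (p 0)) '' σ₁ = σ₁ := by
  ext q
  constructor
  · rintro ⟨p, hp, rfl⟩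
    exact psi_mem hp.1 hp.2
  · intro hq
    refine ⟨fun _ => psiInv (q 0), psiInv_mem hq.1 hq.2, ?_⟩
    funext i; rw [Fin.fin_one_eq_zero i]; exact psi_psiInv hq.1 hq.2

/-- `G` is a left inverse of `Ψ` (as maps of `ℝ¹`) on `σ₁`. [folklore] -/
theorem G_psi {p : Fin 1 → ℝ} (hp : p ∈ σ₁) : G (fun _ => psi (p 0)) = p := by
  funext i; rw [Fin.fin_one_eq_zero i]; exact psiInv_psi hp.1 hp.2

end AokiShiodaSixteen

open AokiShiodaSixteen in
/-- **Stub S1 `stub_aokiShiodaSixteen`** of line `aoki-shioda-cm-lift` (registered signature):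
the `B(1/9,2/3)` kernel on `(0,1)` is KZ-equivalent to `3^{-1/3}` times the SUM of the `B(2/9,5/9)`
and `B(2/9,2/9)` kernels — ONE change of variables `x = Ψ(u)` (the real branch of the Aoki–Shioda /
CM correspondence of `F₉`), built with the landed dimension-one rule-(2) engine, then one
integrand-identification move. [cite: KontsevichZagier2001, §1.2 rule (2)] -/
theorem stub_aokiShiodaSixteen :
    ∀ (r r' : Literature.NumberTheory.Transcendental.KZ.IntegralRep 1), r.domain = {x | x 0 ∈ Set.Ioo (0:ℝ) 1} → Set.EqOn r.integrand (fun x => (x 0) ^ (-(8:ℝ)/9) * (1 - x 0) ^ (-(1:ℝ)/3)) r.domain → r'.domain = {x | x 0 ∈ Set.Ioo (0:ℝ) 1} → Set.EqOn r'.integrand (fun x => (3:ℝ) ^ (-(1:ℝ)/3) * ((x 0) ^ (-(7:ℝ)/9) * (1 - x 0) ^ (-(4:ℝ)/9) + (x 0) ^ (-(7:ℝ)/9) * (1 - x 0) ^ (-(7:ℝ)/9))) r'.domain → Literature.NumberTheory.Transcendental.KZ.Equivalent r r' := by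
  intro r r' hrd hri hr'd hr'i
  have hr'σ : r'.domain = σ₁ := hr'd
  have hrσ : r.domain = σ₁ := hrd
  -- the data of the push-forward along Ψ
  have hφ : IsSemialgebraicFunOn ℚ r'.domain (fun p => psi (p 0)) := by rw [hr'σ]; exact sa_psi
  have hφ' : IsSemialgebraicFunOn ℚ r'.domain (fun p => dpsi (p 0)) := by rw [hr'σ]; exact sa_dpsi
  have hder : ∀ p ∈ r'.domain, HasDerivAt psi (dpsi (p 0)) (p 0) := fun p hp => by
    rw [hr'σ] at hp; exact hasDerivAt_psi' hp.1 hp.2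
  have hne : ∀ p ∈ r'.domain, dpsi (p 0) ≠ 0 := fun p hp => by
    rw [hr'σ] at hp; exact (dpsi_pos hp.1 hp.2).ne'
  have himg : (fun p : Fin 1 → ℝ => fun _ : Fin 1 => psi (p 0)) '' r'.domain = σ₁ := by
    rw [hr'σ]; exact image_psi
  have hG : IsSemialgebraicMapOn ℚ ((fun p : Fin 1 → ℝ => fun _ : Fin 1 => psi (p 0)) '' r'.domain) G := by
    rw [himg]; exact sa_G
  have hGφ : ∀ p ∈ r'.domain, G (fun _ => psi (p 0)) = p := fun p hp => by
    rw [hr'σ] at hp; exact G_psi hp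
  obtain ⟨s, hsd, hsi, hrel⟩ :=
    Summit.KontsevichZagierPeriods.HermiteRigidity.GenusTwoCycleTransfer.stub_pushforwardDimOne
      r' psi dpsi G hφ hφ' hder hne hG hGφ
  -- (i) r' ∼ s : one change of variables
  have e1 : KZ.Equivalent r' s := KZ.changeOfVariablesRel_subset_relations hrel
  -- (ii) s ∼ r : same domain, same integrand on it
  have hsd' : r.domain = s.domain := by rw [hsd, himg, hrσ]
  have heq : Set.EqOn s.integrand r.integrand s.domain := by
    intro y hy
    rw [hsd] at hy
    obtain ⟨p, hp, rfl⟩ := hy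
    have hp' : p ∈ σ₁ := by rw [hr'σ] at hp; exact hp
    have hΨ := psi_mem hp'.1 hp'.2
    have hΦp : (fun _ : Fin 1 => psi (p 0)) ∈ r.domain := by rw [hrσ]; exact hΨ
    rw [hsi p hp, hr'i hp, hri hΦp, abs_of_pos (dpsi_pos hp'.1 hp'.2),
      div_eq_iff (dpsi_pos hp'.1 hp'.2).ne']
    exact (jacobian_u hp'.1 hp'.2).symm
  have e2 : KZ.Equivalent s r := KZ.of_sub_of_mem_relations_of_eqOn hsd' heq
  exact (e1.trans e2).symm

end Summit.KontsevichZagierPeriods.KontsevichZagierPeriods.Cruxes.TriplicationAccessible.AokiShiodaCmLift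

end
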